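import Literature.NumberTheory.LFunctions.WeilFirstPrimePositivityC

/-!
F3 / BC5 witness for line `exact-rung-log2` (crux `GronwallLeakage`, stmt-RiemannHypothesis-1037):
the rung family `HeadRung A := WeilPositivityOn A` SPECIALISES to the proved floor `A = (log 3)/2`
(`Literature.NumberTheory.LFunctions.weilPositivityOn_log_three_half`, Stage-C kernel certificate `weilCert3C`,
RH-free, beyond the printed floor `(log 2)/2` of Yoshida 1992 Thm 1). No `sorry`.
-/

set_option linter.dupNamespace false

noncomputable section

open Literature.NumberTheory.LFunctions

namespace Summit.RiemannHypothesis.RiemannHypothesis.Cruxes.GronwallLeakage.ExactRungLog2.Special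

/-- Rung family (verbatim from `Lines/exact_rung_log2.lean`). -/
def HeadRung (A : ℝ) : Prop := WeilPositivityOn A

/-- **WITNESS:** the floor rung is a theorem of the tree. -/
example : HeadRung (Real.log 3 / 2) := by
  simpa [HeadRung] using weilPositivityOn_log_three_half

/-- Named form, for citation. -/
theorem headRung_floor : HeadRung (Real.log 3 / 2) := weilPositivityOn_log_three_half

/-- And every smaller window (antitone family). -/
theorem headRung_of_le_floor {A : ℝ} (hA : A ≤ Real.log 3 / 2) : HeadRung A :=
  WeilPositivityOn.mono hA headRung_floor

end Summit.RiemannHypothesis.RiemannHypothesis.Cruxes.GronwallLeakage.ExactRungLog2.Special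

end
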